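import Mathlib
import Summits.CriticalPhenomena.PercolationContinuityZ3.Theorems.PercNearOneGluingNoHeavyLowerTailOrderedDifferencesLocal

/-!
# Least traces on BOTH sides: the mixed peeling form of the local criterion (complementation duality)

Helper file for crux `stmt-CriticalPhenomena-4575` (`NoHeavyLowerTail`, route `PercNearOneGluingNoHeavy`),
new-inequality factory seat `prim-ineq-gen-3` (gen 24).  Everything here is PROVED; no definitions.

`…OrderedDifferencesLocal` proved: if every non-empty sub-family `ℬ ⊆ 𝒜` has a MAXIMAL member with least traces relative to `ℬ`,
the pencil rows `C ↦ (E ↦ [E ⊆ C] + t [E ∩ C = ∅])` of `𝒜` over `𝒜 \\ 𝒜` are independent over every field (`t ≠ 0`, `t² ≠ 1`).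
The pencil is self-dual under complementation in a ground set `S ⊇ ⋃ 𝒜`: the row of `S \ C` at `t⁻¹` is `t⁻¹ ×` the row of `C` at `t`
(same difference family), so a dependency of `ℬ` at `t` is a dependency of `ℬᶜ = {S \ C}` at `t⁻¹` (`dep_compl`).  Hence a MINIMAL
member `B` of the support whose complement `S \ B` has least traces relative to `ℬᶜ` serves as well (`S \ B` is maximal in `ℬᶜ`):

* `linearIndependent_pencil_of_leastTraces_mixed` — if every non-empty `ℬ ⊆ 𝒜` has either a maximal member with least traces
  relative to `ℬ`, or a minimal member whose complement has least traces relative to `ℬᶜ`, then the pencil rows of `𝒜` are linearly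
  independent over every field for `t ≠ 0`, `t * t ≠ 1`.  (Random families on ≤ 6 points: ≈ 95 % satisfy the hypothesis, against
  ≈ 38 % for the maximal-only form; the Fano plane — dependent over `ZMod 7` — satisfies neither.)
(prim-ineq-gen-3 gen 24, 2026-08-24; memo `FINDINGS-gen24.md` F24-4.)
-/

namespace Summit.CriticalPhenomena.PercolationContinuityZ3.Theorems

namespace OrderedDifferences

open Finset
open scoped FinsetFamily

variable {α : Type*} [DecidableEq α] {K : Type*} [Field K]

/-- Choice of a least-trace map at `A` (local copy of the private helper of `…OrderedDifferencesLocal`). -/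
private theorem exists_leastTrace_map' (ℬ : Finset (Finset α)) (A : Finset α)
    (h : ∀ B ∈ ℬ, ∃ X ∈ ℬ, A \ B ⊆ X ∧ ∀ C ∈ ℬ, A \ B ⊆ C → X ∩ A ⊆ C) :
    ∃ φ : Finset α → Finset α, (∀ B ∈ ℬ, ∃ C ∈ ℬ, φ (B ∩ A) = C ∩ A) ∧ (∀ B ∈ ℬ, A \ B ⊆ φ (B ∩ A)) ∧
      ∀ B ∈ ℬ, ∀ C ∈ ℬ, A \ B ⊆ C → φ (B ∩ A) ⊆ C := by
  classical
  let φ : Finset α → Finset α := fun T =>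
    if h : ∃ X ∈ ℬ, A \ T ⊆ X ∧ ∀ C ∈ ℬ, A \ T ⊆ C → X ∩ A ⊆ C then (Classical.choose h) ∩ A else ∅
  have hφspec : ∀ B ∈ ℬ, ∃ X ∈ ℬ, φ (B ∩ A) = X ∩ A ∧ A \ B ⊆ X ∧ ∀ C ∈ ℬ, A \ B ⊆ C → X ∩ A ⊆ C := by
    intro B hB
    have hsd : A \ (B ∩ A) = A \ B := by
      ext x; simp only [mem_sdiff, mem_inter, not_and]; tauto
    have hex : ∃ X ∈ ℬ, A \ (B ∩ A) ⊆ X ∧ ∀ C ∈ ℬ, A \ (B ∩ A) ⊆ C → X ∩ A ⊆ C := by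
      rw [hsd]; exact h B hB
    have hXs := Classical.choose_spec hex
    refine ⟨Classical.choose hex, hXs.1, ?_, ?_, ?_⟩
    · simp only [φ, dif_pos hex]
    · rw [← hsd]; exact hXs.2.1
    · intro C hC hC'; exact hXs.2.2 C hC (by rw [hsd]; exact hC')
  refine ⟨φ, ?_, ?_, ?_⟩
  · intro B hB
    obtain ⟨X, hX, hXe, -, -⟩ := hφspec B hB
    exact ⟨X, hX, hXe⟩
  · intro B hB
    obtain ⟨X, hX, hXe, hsub, -⟩ := hφspec B hB
    rw [hXe]
    exact subset_inter hsub sdiff_subset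
  · intro B hB C hC hBC
    obtain ⟨X, hX, hXe, -, hle⟩ := hφspec B hB
    rw [hXe]
    exact hle C hC hBC

/-- **Complementation duality for dependencies.**  Let every member of `ℬ` lie inside `S`, and let `c` satisfy the dependency
equations of the pencil of `ℬ` at `t ≠ 0`: `∑_{C ∈ ℬ} c_C ([E ⊆ C] + t [E ∩ C = ∅]) = 0` for all `E ∈ ℬ \\ ℬ`.  Then
`C' ↦ c (S \ C')` satisfies the dependency equations of the complement family `ℬᶜ = {S \ C : C ∈ ℬ}` at `t⁻¹`
(the two families have the same difference family, and `[E ⊆ S \ C] = [E ∩ C = ∅]`, `[E ∩ (S \ C) = ∅] = [E ⊆ C]` for `E ⊆ S`). -/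
theorem dep_compl (ℬ : Finset (Finset α)) (S : Finset α) (hS : ∀ C ∈ ℬ, C ⊆ S) (c : Finset α → K)
    {t : K} (ht0 : t ≠ 0)
    (hdep : ∀ E ∈ ℬ \\ ℬ, ∑ C ∈ ℬ, c C * ((if E ⊆ C then (1 : K) else 0) +
      t * (if Disjoint E C then (1 : K) else 0)) = 0) :
    ∀ E ∈ (ℬ.image fun C => S \ C) \\ (ℬ.image fun C => S \ C),
      ∑ C' ∈ ℬ.image (fun C => S \ C), c (S \ C') * ((if E ⊆ C' then (1 : K) else 0) +
        t⁻¹ * (if Disjoint E C' then (1 : K) else 0)) = 0 := by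
  classical
  intro E hE
  -- `E` is a difference of `ℬ` and lies inside `S`
  obtain ⟨X', hX', Y', hY', rfl⟩ := mem_diffs.mp hE
  obtain ⟨X, hX, rfl⟩ := mem_image.mp hX'
  obtain ⟨Y, hY, rfl⟩ := mem_image.mp hY'
  have hEeq : (S \ X) \ (S \ Y) = Y \ X := by
    ext x
    simp only [mem_sdiff, not_and, not_not]
    constructor
    · rintro ⟨⟨hxS, hxX⟩, h⟩; exact ⟨h hxS, hxX⟩
    · rintro ⟨hxY, hxX⟩; exact ⟨⟨hS Y hY hxY, hxX⟩, fun _ => hxY⟩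
  have hEmem : Y \ X ∈ ℬ \\ ℬ := mem_diffs.mpr ⟨Y, hY, X, hX, rfl⟩
  have hES : Y \ X ⊆ S := (sdiff_subset).trans (hS Y hY)
  rw [hEeq]
  -- reindex the sum over `ℬᶜ` by `C ↦ S \ C` (injective on `ℬ`)
  have hinj : ∀ C₁ ∈ ℬ, ∀ C₂ ∈ ℬ, S \ C₁ = S \ C₂ → C₁ = C₂ := by
    intro C₁ h₁ C₂ h₂ h
    rw [← Finset.sdiff_sdiff_eq_self (hS C₁ h₁), h, Finset.sdiff_sdiff_eq_self (hS C₂ h₂)]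
  rw [sum_image hinj]
  have e : ∑ C ∈ ℬ, c (S \ (S \ C)) * ((if Y \ X ⊆ S \ C then (1 : K) else 0) +
      t⁻¹ * (if Disjoint (Y \ X) (S \ C) then (1 : K) else 0)) =
      t⁻¹ * ∑ C ∈ ℬ, c C * ((if Y \ X ⊆ C then (1 : K) else 0) +
        t * (if Disjoint (Y \ X) C then (1 : K) else 0)) := by
    rw [mul_sum]
    refine sum_congr rfl fun C hC => ?_
    rw [Finset.sdiff_sdiff_eq_self (hS C hC)]
    have e1 : (Y \ X ⊆ S \ C) ↔ Disjoint (Y \ X) C := by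
      rw [subset_sdiff]; exact ⟨fun h => h.2, fun h => ⟨hES, h⟩⟩
    have e2 : Disjoint (Y \ X) (S \ C) ↔ Y \ X ⊆ C := by
      constructor
      · intro h x hx
        by_contra hxC
        exact disjoint_left.mp h hx (mem_sdiff.mpr ⟨hES hx, hxC⟩)
      · intro h
        exact disjoint_left.mpr fun x hx hx' => (mem_sdiff.mp hx').2 (h hx)
    simp only [e1, e2]
    have htt : t⁻¹ * t = 1 := inv_mul_cancel₀ ht0
    generalize (if Disjoint (Y \ X) C then (1 : K) else 0) = P
    generalize (if Y \ X ⊆ C then (1 : K) else 0) = Q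
    linear_combination (-(c C * P)) * htt
  rw [e, hdep _ hEmem, mul_zero]

/-- **Mixed peeling form of the local criterion.**  Let every member of `𝒜` lie inside `S`.  Suppose every non-empty sub-family
`ℬ ⊆ 𝒜` has EITHER a member `A`, maximal in `ℬ`, with least traces relative to `ℬ` (every co-filter `{C ∩ A : C ∈ ℬ, A \ B ⊆ C}`
has a least element), OR a member `B`, minimal in `ℬ`, whose complement `S \ B` has least traces relative to the complement family
`ℬᶜ = {S \ C : C ∈ ℬ}`.  Then for every field `K` and every `t ∈ K` with `t ≠ 0`, `t * t ≠ 1`, the pencil rows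
`C ↦ (E ↦ [E ⊆ C] + t [E ∩ C = ∅])` of `𝒜` over `𝒜 \\ 𝒜` are linearly independent over `K`. -/
theorem linearIndependent_pencil_of_leastTraces_mixed (𝒜 : Finset (Finset α)) (S : Finset α) (hS : ∀ A ∈ 𝒜, A ⊆ S)
    (hlt : ∀ ℬ ⊆ 𝒜, ℬ.Nonempty →
      (∃ A ∈ ℬ, (∀ C ∈ ℬ, A ⊆ C → C = A) ∧
        ∀ B ∈ ℬ, ∃ X ∈ ℬ, A \ B ⊆ X ∧ ∀ C ∈ ℬ, A \ B ⊆ C → X ∩ A ⊆ C) ∨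
      (∃ B ∈ ℬ, (∀ C ∈ ℬ, C ⊆ B → C = B) ∧
        ∀ C' ∈ ℬ.image (fun C => S \ C), ∃ X' ∈ ℬ.image (fun C => S \ C), (S \ B) \ C' ⊆ X' ∧
          ∀ D' ∈ ℬ.image (fun C => S \ C), (S \ B) \ C' ⊆ D' → X' ∩ (S \ B) ⊆ D'))
    {t : K} (ht0 : t ≠ 0) (ht : t * t ≠ 1) :
    LinearIndependent K (fun A : 𝒜 => fun E : (𝒜 \\ 𝒜 : Finset (Finset α)) =>
      (if (E : Finset α) ⊆ (A : Finset α) then (1 : K) else 0) +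
        t * (if Disjoint (E : Finset α) (A : Finset α) then (1 : K) else 0)) := by
  classical
  rw [Fintype.linearIndependent_iff]
  intro c hc A₀
  set c' : Finset α → K := fun C => if h : C ∈ 𝒜 then c ⟨C, h⟩ else 0 with hc'def
  have hc' : ∀ A : 𝒜, c' A = c A := fun A => by simp only [hc'def, dif_pos A.2]
  have hdep : ∀ E ∈ 𝒜 \\ 𝒜, ∑ C ∈ 𝒜, c' C * ((if E ⊆ C then (1 : K) else 0) +
      t * (if Disjoint E C then (1 : K) else 0)) = 0 := by
    intro E hE
    have h := congr_fun hc ⟨E, hE⟩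
    simp only [Finset.sum_apply, Pi.smul_apply, smul_eq_mul, Pi.zero_apply] at h
    have h' : ∑ x ∈ 𝒜.attach, c x * ((if E ⊆ (x : Finset α) then (1 : K) else 0) +
        t * (if Disjoint E (x : Finset α) then (1 : K) else 0)) = 0 := by
      rwa [← univ_eq_attach]
    rw [← sum_attach 𝒜]
    refine (sum_congr rfl fun A _ => ?_).trans h'
    rw [hc' A]
  by_contra hA₀
  set ℬ : Finset (Finset α) := 𝒜.filter (fun C => c' C ≠ 0) with hℬdef
  have hℬsub : ℬ ⊆ 𝒜 := filter_subset _ _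
  have hℬne : ℬ.Nonempty := ⟨A₀, mem_filter.mpr ⟨A₀.2, by rw [hc' A₀]; exact hA₀⟩⟩
  have hDsub : ℬ \\ ℬ ⊆ 𝒜 \\ 𝒜 := diffs_subset hℬsub hℬsub
  have hdepB : ∀ E ∈ ℬ \\ ℬ, ∑ C ∈ ℬ, c' C * ((if E ⊆ C then (1 : K) else 0) +
      t * (if Disjoint E C then (1 : K) else 0)) = 0 := by
    intro E hE
    rw [hℬdef, sum_filter_of_ne (fun C _ h => by
      intro h0; rw [h0, zero_mul] at h; exact h rfl)]
    exact hdep E (hDsub hE)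
  have hℬS : ∀ C ∈ ℬ, C ⊆ S := fun C hC => hS C (hℬsub hC)
  rcases hlt ℬ hℬsub hℬne with ⟨A, hA, hmax, hltA⟩ | ⟨B, hB, hmin, hltB⟩
  · -- maximal member with least traces: the local lemma at `A` in `ℬ`
    obtain ⟨φ, hφmem, hφsup, hφle⟩ := exists_leastTrace_map' ℬ A hltA
    have h := traceSum_eq_zero_of_leastTraces ℬ hA φ hφmem hφsup hφle c' ht0 ht hdepB A hA
    have e : ℬ.filter (fun C => C ∩ A = A ∩ A) = {A} := by
      ext C
      simp only [mem_filter, inter_self, inter_eq_right, mem_singleton]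
      constructor
      · rintro ⟨hC, hAC⟩; exact hmax C hC hAC
      · rintro rfl; exact ⟨hA, subset_rfl⟩
    rw [e, sum_singleton] at h
    exact (mem_filter.mp hA).2 h
  · -- minimal member whose complement has least traces in `ℬᶜ`: the local lemma at `S \ B` in `ℬᶜ` at `t⁻¹`
    set ℬc : Finset (Finset α) := ℬ.image (fun C => S \ C) with hℬc
    have hBc : S \ B ∈ ℬc := mem_image_of_mem _ hB
    have hdepc := dep_compl ℬ S hℬS c' ht0 hdepB
    have ht0' : t⁻¹ ≠ 0 := inv_ne_zero ht0
    have ht' : t⁻¹ * t⁻¹ ≠ 1 := by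
      intro h
      apply ht
      have : t * t * (t⁻¹ * t⁻¹) = t * t := by rw [h, mul_one]
      calc t * t = t * t * (t⁻¹ * t⁻¹) := this.symm
        _ = (t * t⁻¹) * (t * t⁻¹) := by ring
        _ = 1 := by rw [mul_inv_cancel₀ ht0, one_mul]
    obtain ⟨φ, hφmem, hφsup, hφle⟩ := exists_leastTrace_map' ℬc (S \ B) hltB
    have h := traceSum_eq_zero_of_leastTraces ℬc hBc φ hφmem hφsup hφle (fun C' => c' (S \ C')) ht0' ht' hdepc
      (S \ B) hBc
    -- the trace class of `S \ B` in `ℬᶜ` is `{S \ B}`: `S \ C ⊇ S \ B` forces `C ⊆ B`, hence `C = B`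
    have e : ℬc.filter (fun C' => C' ∩ (S \ B) = (S \ B) ∩ (S \ B)) = {S \ B} := by
      ext C'
      simp only [mem_filter, inter_self, inter_eq_right, mem_singleton]
      constructor
      · rintro ⟨hC', hsub⟩
        obtain ⟨C, hC, rfl⟩ := mem_image.mp hC'
        have hCB : C ⊆ B := by
          intro x hx
          by_contra hxB
          have : x ∈ S \ C := hsub (mem_sdiff.mpr ⟨hℬS C hC hx, hxB⟩)
          exact (mem_sdiff.mp this).2 hx
        rw [hmin C hC hCB]
      · rintro rfl; exact ⟨hBc, subset_rfl⟩
    rw [e, sum_singleton, Finset.sdiff_sdiff_eq_self (hℬS B hB)] at h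
    exact (mem_filter.mp hB).2 h

end OrderedDifferences

end Summit.CriticalPhenomena.PercolationContinuityZ3.Theorems
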